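import Summits.BirchSwinnertonDyer.BirchSwinnertonDyer.Theorems.AlignedTransportAtTwoMainConjectureOfRankZeroBSDAtTwoFineRoadInfResSharp
import Summits.BirchSwinnertonDyer.BirchSwinnertonDyer.Theorems.AlignedTransportAtTwoMainConjectureOfRankZeroBSDAtTwoFineRoadInfResRel
import Literature.NumberTheory.EllipticCurves.GreenbergArchimedeanSelmerFactorAtTwo
import Literature.NumberTheory.EllipticCurves.IwasawaAlgebra
import Mathlib.Algebra.Module.CharacterModule
import HarnessLib

/-!
# Road (b″) netted, the relaxed descent `fd : X'_Δ → X^{rel ∞}(E/ℚ_∞)` — receptacle-free Pontryagin packaging: on the seed cell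
# `res : Sel^{rel ∞}(ℚ_∞) ↪ Sel(ℚ(ζ_{2^∞}))` is injective (att-p4 g3), so EVERY dual `fd` is ONTO and `coker fd = 0` is finite

Cell `bsd-f1-sign2`, WIDTH-5 attach seat `bsd-line-att-p4` (gen 4) on line `birth` of crux C2
stmt-BirchSwinnertonDyer-22298 `MainConjectureOfRankZeroBSDAtTwo`; a `--supports 22298 --as helper` file, companion of `…FineRoadArchKernel`
(`q`) and `…FineRoadFineKernel` (`fyʳ`). HONEST FRAMING: THEOREMS ONLY — no definition, no named fact, no `sorry`; BSD is NOT proved by any of this.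

WHY. The displayed `KatoNetDataRelAtTwo` (K₂ⁿᵉᵗʳ) asks, inside its `∃`, for a relaxed descent `fd : (X' ⧸ range (cX - 1)) →ₗ[Λ] Xr` with
`Finite (Xr ⧸ range fd)`, where `X'` is Kato's `X(E/ℚ(ζ_{2^∞}))` with `Δ`-action `cX` and `Xr` the dual of the relaxed-at-`∞` Selmer group of
`ℚ_∞` (-ty's `Greenberg1999.relaxedSelmerInftyAtTwo`). The dual of `fd` is the restriction `res : Sel^{rel ∞}(ℚ_∞) → Sel(ℚ(ζ_{2^∞}))`
(`InfResRel.resOfLe_relaxedSelmer_mem_selmerGroupOver_kerCyc`), INJECTIVE on the seed cell (`InfResSharp.resOfLe_kerCyclotomicCharacter_injective_two`,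
no rational `2`-torsion ⟹ `E(ℚ(ζ_{2^∞}))[2^∞] = 0`). Dually — for ANY pinned `X'`, `Xr` and ANY compatible `fd` — `fd` is onto (`ℚ/ℤ` divisible):

* §1 (abstract) `surjective_of_dual_injective`: pinned duals `X ≅ Hom(S, ℚ/ℤ)`, `Xr ≅ Hom(R, ℚ/ℤ)`, an INJECTIVE additive `j : R → S`, and any
  map `g : X → Xr` with `toDualR (g x) r = toDual x (j r)` ⟹ `g` is onto (Baer, Mathlib `CharacterModule.dual_surjective_of_injective`);
  `surjective_comp_mkQ` (the same for a map defined on a quotient of `X`).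
* §2 (seed cell) **`fd_surjective`** and **`finite_coker_fd`**: for `W/ℚ` elliptic without rational `2`-torsion, cyclotomic `κ`, ANY `Λ`-module `X'` pinned to
  `Sel_{2^∞}(E/ℚ(ζ_{2^∞}))` (`W.selmerGroupOver 2 (ker χ₂)`) by an additive bijection, ANY `cX`, ANY `Λ`-module `Xr` pinned to
  `relaxedSelmerInftyAtTwo W κ`, and ANY `Λ`-linear `fd : X' ⧸ range(cX − 1) → Xr` dual to `res`: `fd` is ONTO, hence `Finite (Xr ⧸ range fd)` — the K₂ⁿᵉᵗʳ
  conjunct, unconditionally (no Imai, no Ribet), both signs of `Δ_W`.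

References: R. Greenberg, LNM 1716 (1999), §3 Lemma 3.1 (restriction maps) and §4; K. Kato, Astérisque 295 §17.13.
-/

set_option autoImplicit false
-- the Theorems namespace of this sub repeats the summit name by design (D-0017 nested layout)
set_option linter.dupNamespace false

noncomputable section

open scoped Classical

namespace Summit.BirchSwinnertonDyer.BirchSwinnertonDyer.Theorems.AlignedTransportAtTwoFineRoad.DescentKernel

open Literature.NumberTheory.EllipticCurves Literature.NumberTheory.EllipticCurves.IwasawaAlgebra

/-! ## §1 Abstract: the dual of an injective map is onto -/

section Abstract

variable {S R : Type*} [AddCommGroup S] [AddCommGroup R] (j : R →+ S)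
  {X Xr : Type*} [AddCommGroup X] [AddCommGroup Xr]
  (toDual : X →+ (S →+ AddCircle (1 : ℚ))) (toDualR : Xr →+ (R →+ AddCircle (1 : ℚ)))

/-- **The Pontryagin dual of an injective map is ONTO.** If `j : R → S` is injective, `X ≅ Hom(S, ℚ/ℤ)` and `Xr ≅ Hom(R, ℚ/ℤ)` are pinned
duals (`toDualR` onto suffices for nothing here; `toDual` onto and `toDualR` injective are what is used) and `g : X → Xr` satisfies
`toDualR (g x) r = toDual x (j r)`, then `g` is surjective: every character of `R` extends along `j` (`ℚ/ℤ` divisible, Baer).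
[cite: GreenbergLNM1716, §1 (after Conj. 1.3)] -/
theorem surjective_of_dual_injective (hj : Function.Injective j) (hD : Function.Surjective toDual)
    (hR : Function.Injective toDualR) {g : X → Xr} (hg : ∀ (x : X) (r : R), toDualR (g x) r = toDual x (j r)) :
    Function.Surjective g := by
  intro y
  obtain ⟨L, hL⟩ := CharacterModule.dual_surjective_of_injective (R := ℤ) j.toIntLinearMap hj
    (toDualR y : CharacterModule R)
  obtain ⟨x, hx⟩ := hD (L : S →+ AddCircle (1 : ℚ))
  refine ⟨x, hR (AddMonoidHom.ext fun r ↦ ?_)⟩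
  rw [hg, hx]
  exact congrArg (fun χ : CharacterModule R ↦ χ r) hL

end Abstract

/-! ## §2 Seed cell: every dual `fd` of `res : Sel^{rel ∞}(ℚ_∞) ↪ Sel(ℚ(ζ_{2^∞}))` is onto, `coker fd = 0` -/

section SeedCell

open WeierstrassCurve Literature.NumberTheory.GaloisRepresentations ZpExtension
  Literature.NumberTheory.EllipticCurves.Greenberg1999

variable (κ : ZpExtension ℚ 2) (W : WeierstrassCurve ℚ) [W.IsElliptic]

omit [W.IsElliptic] in
/-- The restriction of a relaxed-at-`∞` Selmer class of `ℚ_∞` lies in `Sel_{2^∞}(E/ℚ(ζ_{2^∞}))`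
(`InfResRel.resOfLe_relaxedSelmer_mem_selmerGroupOver_kerCyc`, restated for -ty's `relaxedSelmerInftyAtTwo`). [cite: GreenbergLNM1716, §3 and §4 (PDF p. 106)] -/
theorem resOfLe_mem_selmerGroupOver_of_mem_relaxed (hκ : κ.IsCyclotomic) (s : relaxedSelmerInftyAtTwo W κ) :
    W.resOfLe 2 (InfRes.ker_cyclotomicCharacter_le_kerSubgroup κ hκ) s ∈
      W.selmerGroupOver 2 (GaloisRep.cyclotomicCharacter ℚ 2).toMonoidHom.ker :=
  (InfResRel.resOfLe_relaxedSelmer_mem_selmerGroupOver_kerCyc κ W hκ s.2).1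

/-- **THE RELAXED DESCENT `fd` IS ONTO on the seed cell.** For `W/ℚ` elliptic WITHOUT a rational point of order `2`, the cyclotomic
`ℤ₂`-extension `κ`, ANY abelian group `X'` pinned to `Sel_{2^∞}(E/ℚ(ζ_{2^∞})) = W.selmerGroupOver 2 (ker χ₂)` by a surjective
`toDual'`, ANY subgroup `N ≤ X'` (e.g. `range (cX − 1)`), ANY `Xr` pinned to `Sel^{rel ∞}(ℚ_∞) = relaxedSelmerInftyAtTwo W κ` by an injective
`toDualR`, and ANY map `fd` on `X' ⧸ N` with `toDualR (fd [x]) s = toDual' x (res s)`: `fd` is surjective — because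
`res : H¹(ℚ_∞, E[2^∞]) ↪ H¹(ℚ(ζ_{2^∞}), E[2^∞])` is injective (`InfResSharp.resOfLe_kerCyclotomicCharacter_injective_two`) and `ℚ/ℤ` is
divisible. [cite: GreenbergLNM1716, §3 Lemma 3.1] -/
theorem fd_surjective (ht : ∀ x : ℚ, ¬ HasRationalTwoTorsionX W x) (hκ : κ.IsCyclotomic)
    {X' : Type*} [AddCommGroup X'] (N : AddSubgroup X')
    (toDual' : X' →+ (W.selmerGroupOver 2 (GaloisRep.cyclotomicCharacter ℚ 2).toMonoidHom.ker →+ AddCircle (1 : ℚ)))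
    (hD : Function.Surjective toDual')
    {Xr : Type*} [AddCommGroup Xr] (toDualR : Xr →+ (relaxedSelmerInftyAtTwo W κ →+ AddCircle (1 : ℚ)))
    (hR : Function.Injective toDualR) {fd : X' ⧸ N → Xr}
    (hfd : ∀ (x : X') (s : relaxedSelmerInftyAtTwo W κ),
      toDualR (fd (QuotientAddGroup.mk x)) s =
        toDual' x ⟨W.resOfLe 2 (InfRes.ker_cyclotomicCharacter_le_kerSubgroup κ hκ) s,
          resOfLe_mem_selmerGroupOver_of_mem_relaxed κ W hκ s⟩) :
    Function.Surjective fd := by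
  set h := InfRes.ker_cyclotomicCharacter_le_kerSubgroup κ hκ with hh
  -- the restriction as a map `Sel^{rel ∞}(ℚ_∞) → Sel(ℚ(ζ_{2^∞}))`, injective on the seed cell
  let j : relaxedSelmerInftyAtTwo W κ →+ W.selmerGroupOver 2 (GaloisRep.cyclotomicCharacter ℚ 2).toMonoidHom.ker :=
    ((W.resOfLe 2 h).comp (relaxedSelmerInftyAtTwo W κ).subtype).codRestrict _
      fun s ↦ resOfLe_mem_selmerGroupOver_of_mem_relaxed κ W hκ s
  have hj : Function.Injective j := by
    intro s s' hss'
    have e := congrArg (fun u : W.selmerGroupOver 2 (GaloisRep.cyclotomicCharacter ℚ 2).toMonoidHom.ker ↦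
      (u : W.subgroupH1 2 (GaloisRep.cyclotomicCharacter ℚ 2).toMonoidHom.ker)) hss'
    exact Subtype.ext (InfResSharp.resOfLe_kerCyclotomicCharacter_injective_two W κ ht hκ e)
  have hsurj : Function.Surjective (fd ∘ QuotientAddGroup.mk) :=
    surjective_of_dual_injective j toDual' toDualR hj hD hR (g := fd ∘ QuotientAddGroup.mk) fun x s ↦ hfd x s
  exact Function.Surjective.of_comp hsurj

/-- **`coker fd` is finite (indeed trivial) on the seed cell** — the K₂ⁿᵉᵗʳ conjunct `Finite (Xr ⧸ LinearMap.range fd)` for ANY `Λ`-module `X'`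
pinned to `Sel(ℚ(ζ_{2^∞}))`, ANY `Λ`-linear `cX`, ANY `Λ`-module `Xr` pinned to `Sel^{rel ∞}(ℚ_∞)` and ANY `Λ`-linear
`fd : X' ⧸ range(cX − 1) → Xr` dual to the restriction. No Imai, no Ribet; both signs of `Δ_W`. [cite: GreenbergLNM1716, §3 Lemma 3.1]
[cite: Kato2004Asterisque, §17.13] -/
theorem finite_coker_fd (ht : ∀ x : ℚ, ¬ HasRationalTwoTorsionX W x) (hκ : κ.IsCyclotomic)
    {X' : Type*} [AddCommGroup X'] [_root_.Module (IwasawaAlgebra 2) X']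
    (toDual' : X' →+ (W.selmerGroupOver 2 (GaloisRep.cyclotomicCharacter ℚ 2).toMonoidHom.ker →+ AddCircle (1 : ℚ)))
    (hD : Function.Bijective toDual') (cX : X' →ₗ[IwasawaAlgebra 2] X')
    {Xr : Type*} [AddCommGroup Xr] [_root_.Module (IwasawaAlgebra 2) Xr]
    (toDualR : Xr →+ (relaxedSelmerInftyAtTwo W κ →+ AddCircle (1 : ℚ))) (hR : Function.Bijective toDualR)
    (fd : (X' ⧸ LinearMap.range (cX - 1)) →ₗ[IwasawaAlgebra 2] Xr)
    (hfd : ∀ (x : X') (s : relaxedSelmerInftyAtTwo W κ),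
      toDualR (fd (Submodule.Quotient.mk x)) s =
        toDual' x ⟨W.resOfLe 2 (InfRes.ker_cyclotomicCharacter_le_kerSubgroup κ hκ) s,
          resOfLe_mem_selmerGroupOver_of_mem_relaxed κ W hκ s⟩) :
    Finite (Xr ⧸ LinearMap.range fd) := by
  have hsurj : Function.Surjective fd :=
    fd_surjective κ W ht hκ (LinearMap.range (cX - 1)).toAddSubgroup toDual' hD.surjective toDualR hR.injective
      (fd := fun q ↦ fd q) fun x s ↦ hfd x s
  have htop : LinearMap.range fd = ⊤ := LinearMap.range_eq_top.mpr hsurj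
  rw [htop]
  infer_instance

end SeedCell

end Summit.BirchSwinnertonDyer.BirchSwinnertonDyer.Theorems.AlignedTransportAtTwoFineRoad.DescentKernel

end
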